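import Literature.Probability.RandomPlanarGeometry.HexSAWSurfaceWallRenewalBlocksSeven
import Literature.Probability.RandomPlanarGeometry.HexSAWSurfaceWallRenewalFloorSeventeen
import Literature.Probability.RandomPlanarGeometry.HexSAWSurfaceFifthOrderUpper
import HarnessLib

/-!
# A seventh-order floor for `β(y)²`: `liminf y⁶ (β(y)² − y − 1/y − 1/y² − 2/y³ − 4/y⁴ − 6/y⁵) ≥ 12`

`β(y) = wallRate y` is the exponential growth rate of wall bridges of self-avoiding walks on the brick-wall (hexagonal) lattice along a
zigzag wall with contact fugacity `y` («WALL-BRIDGES»).  The lane's strong-adsorption expansion reads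
`β(y)² = y + 1/y + 1/y² + 2/y³ + 4/y⁴ + 6/y⁵ + o(y⁻⁵)` (exact orders in «SECOND-ORDER-SHARP», «FOURTH-ORDER-EXACT», «FIFTH-ORDER-UPPER»,
«SIXTH-LOWER»/«SIXTH-ORDER-UPPER»).  This module proves the next order FROM BELOW:

  ★★ `eventually_twelve_sub_le_pow_six_mul_wallRate_sq_sub : ∀ ε > 0, ∀ᶠ y, 12 − ε ≤ y⁶ (β(y)² − y − 1/y − 1/y² − 2/y³ − 4/y⁴ − 6/y⁵)`,

equivalently `β(y)² ≥ y + 1/y + 1/y² + 2/y³ + 4/y⁴ + 6/y⁵ + (12 − ε)/y⁶` eventually (`eventually_seventh_order_floor`), and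
`twelve_le_of_tendsto_pow_six_mul_wallRate_sq_sub : (y⁶(…) → L) → 12 ≤ L`.

METHOD (the one of «SIXTH-LOWER», one diagonal further; the exactness of the sixth coefficient is NOT used — `6/y⁵` is merely
subtracted).  Kesten's identity `Σ_s f_s(y) = 1` for `y > μ⁴` (`hasSum_pwbLaw`, «WALL-RENEWAL»; [MadrasSlade1993, §4.2, (4.2.4),
Theorem 4.2.2], [Kesten 1963, §4]) restricted to the EXHIBITED irreducible classes `(s, v)` with `s − v ≤ 7` — the tree's `(1,1)`, `(3,1)`,
`(4,1)`, `(5,1)×3` (`f₃ = y/β⁶`, `f₄ = y/β⁸`, `f₅ = 3y/β¹⁰`), «FLOOR-SEVENTEEN»'s `(6,2)`, «BLOCKS»' `(6,1)×6, (7,1)×15, (7,2)×3, (8,2)×11,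
(9,3)×1` and «BLOCKS-SEVEN»'s `(8,1)×38, (9,2)×34, (10,3)×7` — gives, with `B = β²` (§2),

  `y/B + y/B³ + y/B⁴ + 3y/B⁵ + (6y + y²)/B⁶ + (15y + 3y²)/B⁷ + (38y + 11y²)/B⁸ + (34y² + y³)/B⁹ + 7y³/B¹⁰ ≤ 1`,

which is LINEAR in `B − y`; multiplying by `y⁶B` yields the closed form (§3), with `r = y/B`,

  `T(y) := y⁶(β² − y − 1/y − 1/y² − 2/y³ − 4/y⁴ − 6/y⁵) ≥ G(y, r) := y⁵(r² − 1) + y⁴(r³ − 1) + y³(3r⁴ + r⁵ − 2) + y²(6r⁵ + 3r⁶ − 4)`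
  `+ y(15r⁶ + 11r⁷ + r⁸ − 6) + (38r⁷ + 34r⁸ + 7r⁹)`.

The divergences `y⁵, …, y` of `G` cancel against the known orders `1, 1, 2, 4`: with `E = y²(1 − r) → 1`, `F = y⁴(1 − r) − y² − y → 1`
and `H = y⁵(1 − r) − y³ − y² − y → 2` (these follow from `y(β² − y) → 1`, `y³(β² − y − 1/y − 1/y²) → 2` and
`y⁴(β² − y − 1/y − 1/y² − 2/y³) → 4` by limit algebra; the relations `y(E − 1) = 1 + F/y`, `y(F − 1) = H`, `r = 1 − E/y²` are exact),
`G(y, r) = R(E, F, H, 1/y)` IDENTICALLY for a polynomial `R` (§0, `ring`), and `R(1, 1, 2, 0) = 12`.  Hence `G → 12` (§4) and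
`liminf T ≥ 12`.  In the census bookkeeping: `12 = N₈₁ + N₉₂ + N₁₀,₃ − 67 = 38 + 34 + 7 − 67`; IF the exhibited lists are complete through
the diagonal `s − v = 7` (the lane's enumerator says so; not proved) and the expansion continues, the seventh coefficient is `a₆ = 12`.

CONTENTS. §0 private plumbing (`μ⁴ ≥ 4`, `f_s = Λ_{2s}/B^s`, Kesten partial sums, `f₁ ≥ y/B`, the limits `y/B → 1`, `E → 1`, `F → 1`,
`H → 2`, the polynomials `G`, `R`, the substitution identity, `R(E, F, H, 1/y) → 12`, and `6y + y² ≤ Λ₁₂` (private twin of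
«SIXTH-LOWER»'s, which this file does not import)) · §2 ★★ `seventh_order_partial_sum_le_one` · §3 ★★ `seventh_order_lower` · §4 ★★
`tendsto_seventh_order_lower` (`G → 12`), ★★ `eventually_twelve_sub_le_pow_six_mul_wallRate_sq_sub`, ★★ `eventually_seventh_order_floor`,
★ `twelve_le_of_tendsto_pow_six_mul_wallRate_sq_sub`.

HONEST LABEL.  LANE THEOREM (a one-sided bound) for this model; the printed sources carry the first-order statement `β ∼ √y` only
([BeatonBousquetMelouDeGierDuminilCopinGuttmann2014, §3.1, Proposition 5 and the remark on p. 10 (arXiv v5)]) and the general renewal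
theory ([MadrasSlade1993, §4.2], [Kesten 1963, §4]); the floor `12` is computed in this lane — NEW IN WRITING (modest), not a quotation.
NOT CLAIMED: the seventh-order LIMIT (no upper bound of order `y⁻⁶` is in the tree beyond «SIXTH-ORDER-UPPER»'s `57395700/y⁶`), the
completeness of any block list, anything for `y ≤ μ⁴`, the armchair wall, numerics.
-/

namespace Literature.Probability.RandomPlanarGeometry.SAW.HexBW.Wall

open Finset Filter Function
open Literature.Probability.LatticeModels
open _root_.Topology Asymptotics

variable {y : ℝ}

/-! ### §0  Private plumbing -/

/-- `μ² = 2 + √2`. [cite: DuminilCopinSmirnov2012, Theorem 1] -/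
private theorem mu_sq_sv : hexConnectiveConstant ^ 2 = 2 + Real.sqrt 2 := by
  rw [hexConnectiveConstant_eq_inv, inv_pow]; exact inv_eq_of_mul_eq_one_right hexCriticalFugacity_sq

/-- `4 ≤ μ⁴`. [cite: DuminilCopinSmirnov2012, Theorem 1] -/
private theorem four_le_mu_four_sv : 4 ≤ hexConnectiveConstant ^ 4 := by
  have h2 : 0 ≤ Real.sqrt 2 := Real.sqrt_nonneg 2
  calc (4 : ℝ) ≤ (2 + Real.sqrt 2) ^ 2 := by nlinarith
    _ = hexConnectiveConstant ^ 4 := by rw [← mu_sq_sv]; ring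

/-- `f_s(y) = Λ_{2s}(y)/(β(y)²)^s`. [cite: MadrasSlade1993, Section 4.2, (4.2.2) (p. 91)] -/
private theorem pwbLaw_eq_sv (y : ℝ) (s : ℕ) : pwbLaw y s = IPWB (2 * s) y / (wallRate y ^ 2) ^ s := by
  rw [pwbLaw, pow_mul]

/-- A lower bound for `Λ_{2s}(y)` is a lower bound for `f_s(y)·(β²)^s`. [cite: MadrasSlade1993, Section 4.2, (4.2.2) (p. 91)] -/
private theorem div_le_pwbLaw_sv {s m : ℕ} (hm : m = 2 * s) {a : ℝ} (ha : a ≤ IPWB m y) : a / (wallRate y ^ 2) ^ s ≤ pwbLaw y s := by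
  subst hm
  rw [pwbLaw_eq_sv]
  exact div_le_div_of_nonneg_right ha (pow_nonneg (sq_nonneg _) _)

/-- Kesten partial sums: `Σ_{s ∈ S} f_s(y) ≤ 1` for `y > μ⁴`. [cite: MadrasSlade1993, Section 4.2, (4.2.4) and Theorem 4.2.2 (pp. 91–92)] [cite: Kesten1963SAW, Section 4] -/
private theorem sum_pwbLaw_le_one_sv (hy : hexConnectiveConstant ^ 4 < y) (S : Finset ℕ) : ∑ s ∈ S, pwbLaw y s ≤ 1 := by
  have hy0 : 0 ≤ y := by have := four_le_mu_four_sv; linarith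
  exact sum_le_hasSum S (fun s _ => pwbLaw_nonneg hy0 s) (hasSum_pwbLaw hy)

/-- `f₁(y) ≥ y/β²` (the atom `(0,0) → (1,0) → (2,0)`). [cite: MadrasSlade1993, Section 4.2, (4.2.2) (p. 91)] -/
private theorem div_sq_wallRate_le_pwbLaw_one_sv (hy : 0 ≤ y) : y / wallRate y ^ 2 ≤ pwbLaw y 1 := by
  obtain ⟨m, hm⟩ : ∃ m : ℕ, m = 2 * 1 := ⟨_, rfl⟩
  have h := straightWalk_mem_pwb 1
  rw [← hm] at h
  have hmem : Zd.straightWalk 2 m ∈ ipwb m := by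
    rw [mem_ipwb]
    refine ⟨h.1, by omega, fun k hk1 hk2 hr => ?_⟩
    have hk : k % 2 = 0 := hr.2.1
    omega
  have h1 : y ^ visits m (Zd.straightWalk 2 m) ≤ IPWB m y := Finset.single_le_sum (fun _ _ => pow_nonneg hy _) hmem
  rw [h.2] at h1
  have h2 := div_le_pwbLaw_sv hm h1
  rwa [pow_one, pow_one] at h2

/-- `6·y + y² ≤ Λ₁₂(y)` (`y ≥ 0`): «BLOCKS»' six one-visit twelves and «FLOOR-SEVENTEEN»'s `qw` (private twin of «SIXTH-LOWER»'s
`six_mul_add_sq_le_IPWB_twelve`, which this file does not import). [cite: Kesten1963SAW, Section 4] [cite: MadrasSlade1993, Section 4.2] -/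
private theorem six_mul_add_sq_le_IPWB_twelve_sv {m : ℕ} (hm : m = 12) (hy : 0 ≤ y) : 6 * y + y ^ 2 ≤ IPWB m y := by
  have h := card_mul_pow_add_le_IPWB (W₂ := fun _ : Fin 1 => Twelve.qw) TwelveOne.W_injective (fun i j _ => Subsingleton.elim i j)
    (TwelveOne.W_mem_ipwb hm) (fun _ => qw_mem_ipwb hm) (v₁ := 1) (v₂ := 2) (fun i => by rw [hm]; exact TwelveOne.visits_W i)
    (fun _ => by rw [hm]; exact Twelve.visits_qw) (by norm_num) hy
  simpa using h

/-- `y/β² → 1` (`β ∼ √y`). [cite: BeatonBousquetMelouDeGierDuminilCopinGuttmann2014, Section 3.1, Proposition 5 (arXiv v5 p. 9)] -/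
private theorem tendsto_div_sq_wallRate_sv : Tendsto (fun y : ℝ => y / wallRate y ^ 2) atTop (𝓝 1) := by
  have h1 : Tendsto (fun y : ℝ => ((wallRate y / Real.sqrt y) ^ 2)⁻¹) atTop (𝓝 ((1 : ℝ) ^ 2)⁻¹) :=
    (tendsto_wallRate_div_sqrt.pow 2).inv₀ (by norm_num)
  rw [one_pow, inv_one] at h1
  refine h1.congr' ?_
  filter_upwards [eventually_gt_atTop (0 : ℝ)] with y hy
  rw [div_pow, Real.sq_sqrt hy.le, inv_div]

/-- `E(y) := y²(1 − y/β²) → 1`. [cite: BeatonBousquetMelouDeGierDuminilCopinGuttmann2014, Section 3.1, Proposition 5 (arXiv v5 p. 9)] -/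
private theorem tendsto_E_sv : Tendsto (fun y : ℝ => y ^ 2 * (1 - y / wallRate y ^ 2)) atTop (𝓝 1) := by
  have h := tendsto_mul_wallRate_sq_sub.mul tendsto_div_sq_wallRate_sv
  rw [one_mul] at h
  refine h.congr' ?_
  filter_upwards [eventually_gt_atTop (0 : ℝ)] with y hy
  have hB : wallRate y ≠ 0 := (wallRate_pos y).ne'
  field_simp

/-- `F(y) := y⁴(1 − y/β²) − y² − y → 1` (from `y³(β² − y − 1/y − 1/y²) → 2`, «FOURTH-ORDER-EXACT»).
[cite: BeatonBousquetMelouDeGierDuminilCopinGuttmann2014, Section 3.1, Proposition 5 (arXiv v5 p. 9)] -/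
private theorem tendsto_F_sv : Tendsto (fun y : ℝ => y ^ 4 * (1 - y / wallRate y ^ 2) - y ^ 2 - y) atTop (𝓝 1) := by
  have h := ((tendsto_cube_mul_wallRate_sq_sub_sub.mul tendsto_div_sq_wallRate_sv).sub tendsto_E_sv).sub
    (tendsto_E_sv.div_atTop tendsto_id)
  rw [show (2 : ℝ) * 1 - 1 - 0 = 1 by norm_num] at h
  refine h.congr' ?_
  filter_upwards [eventually_gt_atTop (0 : ℝ)] with y hy
  have hB : wallRate y ≠ 0 := (wallRate_pos y).ne'
  have hy' : y ≠ 0 := hy.ne'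
  simp only [id]
  field_simp
  ring

/-- `H(y) := y⁵(1 − y/β²) − y³ − y² − y → 2` (from `y⁴(β² − y − 1/y − 1/y² − 2/y³) → 4`, «FIFTH-ORDER-UPPER»):
`H = D₄ · (y/β²) − F/y − E − 2E/y − 1` with `D₄ → 4`. [cite: BeatonBousquetMelouDeGierDuminilCopinGuttmann2014, Section 3.1, Proposition 5 (arXiv v5 p. 9)] -/
private theorem tendsto_H_sv : Tendsto (fun y : ℝ => y ^ 5 * (1 - y / wallRate y ^ 2) - y ^ 3 - y ^ 2 - y) atTop (𝓝 2) := by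
  have hu : Tendsto (fun y : ℝ => 1 / y) atTop (𝓝 0) := tendsto_const_nhds.div_atTop tendsto_id
  have h := ((((tendsto_pow_four_mul_wallRate_sq_sub.mul tendsto_div_sq_wallRate_sv).sub (tendsto_F_sv.mul hu)).sub
    tendsto_E_sv).sub ((tendsto_E_sv.mul hu).const_mul 2)).sub_const 1
  rw [show (4 : ℝ) * 1 - 1 * 0 - 1 - 2 * (1 * 0) - 1 = 2 by norm_num] at h
  refine h.congr' ?_
  filter_upwards [eventually_gt_atTop (0 : ℝ)] with y hy
  have hB : wallRate y ≠ 0 := (wallRate_pos y).ne'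
  have hy' : y ≠ 0 := hy.ne'
  field_simp
  ring

/-- The limit polynomial `R(E, F, H, u)`: `G(y, 1 − ε) = R(y²ε, y⁴ε − y² − y, y⁵ε − y³ − y² − y, 1/y)` identically, `R(1, 1, 2, 0) = 12`.
[cite: MadrasSlade1993, Section 4.2, (4.2.4) (p. 91)] -/
private def R_sv (E F H u : ℝ) : ℝ :=
  (1 + u * F) * (E - 16) - 2 * H +
    (-3 * F - 48 * E - 175 * E * u + 3 * E ^ 2 + 28 * E ^ 2 * u + 105 * E ^ 2 * u ^ 2 + 484 * E ^ 2 * u ^ 3 - E ^ 3 * u ^ 2 -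
      22 * E ^ 3 * u ^ 3 - 120 * E ^ 3 * u ^ 4 - 741 * E ^ 3 * u ^ 5 + 8 * E ^ 4 * u ^ 5 + 75 * E ^ 4 * u ^ 6 + 680 * E ^ 4 * u ^ 7 -
      E ^ 5 * u ^ 7 - 24 * E ^ 5 * u ^ 8 - 377 * E ^ 5 * u ^ 9 + 3 * E ^ 6 * u ^ 10 + 120 * E ^ 6 * u ^ 11 - 19 * E ^ 7 * u ^ 13 +
      E ^ 8 * u ^ 15) +
    (38 * (1 - E * u ^ 2) ^ 7 + 34 * (1 - E * u ^ 2) ^ 8 + 7 * (1 - E * u ^ 2) ^ 9)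

/-- The lower comparison function `G(y, r)` (`r = y/β²`). [cite: MadrasSlade1993, Section 4.2, (4.2.4) (p. 91)] -/
private def G_sv (y r : ℝ) : ℝ :=
  y ^ 5 * (r ^ 2 - 1) + y ^ 4 * (r ^ 3 - 1) + y ^ 3 * (3 * r ^ 4 + r ^ 5 - 2) + y ^ 2 * (6 * r ^ 5 + 3 * r ^ 6 - 4) +
    y * (15 * r ^ 6 + 11 * r ^ 7 + r ^ 8 - 6) + (38 * r ^ 7 + 34 * r ^ 8 + 7 * r ^ 9)

/-- The substitution identity `G(y, r) = R(y²(1 − r), y⁴(1 − r) − y² − y, y⁵(1 − r) − y³ − y² − y, 1/y)` (`y ≠ 0`).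
[cite: MadrasSlade1993, Section 4.2, (4.2.4) (p. 91)] -/
private theorem G_eq_R_sv (hy : y ≠ 0) (r : ℝ) :
    G_sv y r = R_sv (y ^ 2 * (1 - r)) (y ^ 4 * (1 - r) - y ^ 2 - y) (y ^ 5 * (1 - r) - y ^ 3 - y ^ 2 - y) (1 / y) := by
  unfold G_sv R_sv
  field_simp
  ring

/-- `R(E(y), F(y), H(y), 1/y) → R(1, 1, 2, 0) = 12`. [cite: BeatonBousquetMelouDeGierDuminilCopinGuttmann2014, Section 3.1, Proposition 5 (arXiv v5 p. 9)] -/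
private theorem tendsto_R_sv :
    Tendsto (fun y : ℝ => R_sv (y ^ 2 * (1 - y / wallRate y ^ 2)) (y ^ 4 * (1 - y / wallRate y ^ 2) - y ^ 2 - y)
      (y ^ 5 * (1 - y / wallRate y ^ 2) - y ^ 3 - y ^ 2 - y) (1 / y)) atTop (𝓝 12) := by
  have hc : Continuous fun p : ℝ × ℝ × ℝ × ℝ => R_sv p.1 p.2.1 p.2.2.1 p.2.2.2 := by unfold R_sv; fun_prop
  have hu : Tendsto (fun y : ℝ => 1 / y) atTop (𝓝 0) := tendsto_const_nhds.div_atTop tendsto_id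
  have h4 := tendsto_E_sv.prodMk_nhds (tendsto_F_sv.prodMk_nhds (tendsto_H_sv.prodMk_nhds hu))
  have h := (hc.tendsto ((1 : ℝ), (1 : ℝ), (2 : ℝ), (0 : ℝ))).comp h4
  have h12 : R_sv 1 1 2 0 = 12 := by norm_num [R_sv]
  rw [h12] at h
  exact h

/-! ### §2  Kesten's identity over the exhibited classes: the seventh-order partial sum is at most one -/

/-- ★★ **The seventh-order partial sum.**  For `y > μ⁴`, with `B = β(y)²`:
`y/B + y/B³ + y/B⁴ + 3y/B⁵ + (6y + y²)/B⁶ + (15y + 3y²)/B⁷ + (38y + 11y²)/B⁸ + (34y² + y³)/B⁹ + 7y³/B¹⁰ ≤ 1`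
— Kesten's identity `Σ_s f_s(y) = 1` restricted to `s ∈ {1,3,…,10}`, with `f₁ ≥ y/B`, `f₃ = y/B³`, `f₄ = y/B⁴`, `f₅ = 3y/B⁵` («TEN-THREE») and
the exhibited lower bounds of «BLOCKS», «BLOCKS-SEVEN», «FLOOR-SEVENTEEN» for `f₆, …, f₁₀`. [cite: Kesten1963SAW, Section 4] [cite: MadrasSlade1993, Section 4.2, (4.2.4) and Theorem 4.2.2 (pp. 91–92)] -/
theorem seventh_order_partial_sum_le_one (hy : hexConnectiveConstant ^ 4 < y) :
    y / wallRate y ^ 2 + y / (wallRate y ^ 2) ^ 3 + y / (wallRate y ^ 2) ^ 4 + 3 * y / (wallRate y ^ 2) ^ 5 +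
      (6 * y + y ^ 2) / (wallRate y ^ 2) ^ 6 + (15 * y + 3 * y ^ 2) / (wallRate y ^ 2) ^ 7 +
      (38 * y + 11 * y ^ 2) / (wallRate y ^ 2) ^ 8 + (34 * y ^ 2 + y ^ 3) / (wallRate y ^ 2) ^ 9 +
      7 * y ^ 3 / (wallRate y ^ 2) ^ 10 ≤ 1 := by
  have hy0 : 0 ≤ y := by have := four_le_mu_four_sv; linarith
  have hS := sum_pwbLaw_le_one_sv hy {1, 3, 4, 5, 6, 7, 8, 9, 10}
  rw [Finset.sum_insert (by decide), Finset.sum_insert (by decide), Finset.sum_insert (by decide), Finset.sum_insert (by decide),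
    Finset.sum_insert (by decide), Finset.sum_insert (by decide), Finset.sum_insert (by decide), Finset.sum_insert (by decide),
    Finset.sum_singleton] at hS
  have h1 := div_sq_wallRate_le_pwbLaw_one_sv hy0
  have h3 : pwbLaw y 3 = y / (wallRate y ^ 2) ^ 3 := by rw [pwbLaw_three, ← pow_mul]
  have h4 : pwbLaw y 4 = y / (wallRate y ^ 2) ^ 4 := by rw [pwbLaw_four_eq, ← pow_mul]
  have h5 : pwbLaw y 5 = 3 * y / (wallRate y ^ 2) ^ 5 := by rw [pwbLaw_five_eq, ← pow_mul]
  have h6 := div_le_pwbLaw_sv (s := 6) (m := 12) (by norm_num) (six_mul_add_sq_le_IPWB_twelve_sv rfl hy0)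
  have h7 := div_le_pwbLaw_sv (s := 7) (m := 14) (by norm_num) (fifteen_mul_add_three_sq_le_IPWB_fourteen rfl hy0)
  have h8 := div_le_pwbLaw_sv (s := 8) (m := 16) (by norm_num) (thirtyEight_mul_add_eleven_sq_le_IPWB_sixteen rfl hy0)
  have h9 := div_le_pwbLaw_sv (s := 9) (m := 18) (by norm_num) (thirtyFour_sq_add_cube_le_IPWB_eighteen rfl hy0)
  have h10 := div_le_pwbLaw_sv (s := 10) (m := 20) (by norm_num) (seven_cube_le_IPWB_twenty rfl hy0)
  linarith

/-! ### §3  The closed-form seventh-order lower bound -/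

/-- ★★ **THE SEVENTH-ORDER LOWER BOUND IN CLOSED FORM.**  For `y > μ⁴`, with `r = y/β(y)²`:
`y⁵(r² − 1) + y⁴(r³ − 1) + y³(3r⁴ + r⁵ − 2) + y²(6r⁵ + 3r⁶ − 4) + y(15r⁶ + 11r⁷ + r⁸ − 6) + (38r⁷ + 34r⁸ + 7r⁹)`
`≤ y⁶ (β(y)² − y − 1/y − 1/y² − 2/y³ − 4/y⁴ − 6/y⁵)`.
(The difference of the two sides is `y⁶ β² · (1 − partial sum) ≥ 0`.)  The left side tends to `12` (§4).
[cite: Kesten1963SAW, Section 4] [cite: MadrasSlade1993, Section 4.2, (4.2.4) (p. 91)] [cite: BeatonBousquetMelouDeGierDuminilCopinGuttmann2014, Section 3.1, Proposition 5 (arXiv v5 p. 9)] -/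
theorem seventh_order_lower (hy : hexConnectiveConstant ^ 4 < y) :
    y ^ 5 * ((y / wallRate y ^ 2) ^ 2 - 1) + y ^ 4 * ((y / wallRate y ^ 2) ^ 3 - 1) +
        y ^ 3 * (3 * (y / wallRate y ^ 2) ^ 4 + (y / wallRate y ^ 2) ^ 5 - 2) +
        y ^ 2 * (6 * (y / wallRate y ^ 2) ^ 5 + 3 * (y / wallRate y ^ 2) ^ 6 - 4) +
        y * (15 * (y / wallRate y ^ 2) ^ 6 + 11 * (y / wallRate y ^ 2) ^ 7 + (y / wallRate y ^ 2) ^ 8 - 6) +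
        (38 * (y / wallRate y ^ 2) ^ 7 + 34 * (y / wallRate y ^ 2) ^ 8 + 7 * (y / wallRate y ^ 2) ^ 9) ≤
      y ^ 6 * (wallRate y ^ 2 - y - 1 / y - 1 / y ^ 2 - 2 / y ^ 3 - 4 / y ^ 4 - 6 / y ^ 5) := by
  have hy0 : 0 < y := by have := four_le_mu_four_sv; linarith
  have hB : 0 < wallRate y ^ 2 := pow_pos (wallRate_pos y) 2
  have hK := seventh_order_partial_sum_le_one hy
  set B := wallRate y ^ 2 with hBdef
  set K := y / B + y / B ^ 3 + y / B ^ 4 + 3 * y / B ^ 5 + (6 * y + y ^ 2) / B ^ 6 + (15 * y + 3 * y ^ 2) / B ^ 7 +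
    (38 * y + 11 * y ^ 2) / B ^ 8 + (34 * y ^ 2 + y ^ 3) / B ^ 9 + 7 * y ^ 3 / B ^ 10 with hKdef
  have key : y ^ 6 * (B - y - 1 / y - 1 / y ^ 2 - 2 / y ^ 3 - 4 / y ^ 4 - 6 / y ^ 5) -
      (y ^ 5 * ((y / B) ^ 2 - 1) + y ^ 4 * ((y / B) ^ 3 - 1) + y ^ 3 * (3 * (y / B) ^ 4 + (y / B) ^ 5 - 2) +
        y ^ 2 * (6 * (y / B) ^ 5 + 3 * (y / B) ^ 6 - 4) + y * (15 * (y / B) ^ 6 + 11 * (y / B) ^ 7 + (y / B) ^ 8 - 6) +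
        (38 * (y / B) ^ 7 + 34 * (y / B) ^ 8 + 7 * (y / B) ^ 9)) =
      y ^ 6 * B * (1 - K) := by
    rw [hKdef]
    field_simp
    ring
  have hpos : 0 ≤ y ^ 6 * B * (1 - K) := mul_nonneg (mul_nonneg (pow_nonneg hy0.le 6) hB.le) (sub_nonneg.2 hK)
  linarith

/-! ### §4  The limit of the comparison function and the floor -/

/-- ★★ The lower comparison function tends to twelve: with `r = y/β(y)²`,
`y⁵(r² − 1) + y⁴(r³ − 1) + y³(3r⁴ + r⁵ − 2) + y²(6r⁵ + 3r⁶ − 4) + y(15r⁶ + 11r⁷ + r⁸ − 6) + (38r⁷ + 34r⁸ + 7r⁹) → 12` — by the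
substitution `G(y, r) = R(E, F, H, 1/y)` with `E → 1`, `F → 1`, `H → 2` (orders one, three and four EXACT).
[cite: BeatonBousquetMelouDeGierDuminilCopinGuttmann2014, Section 3.1, Proposition 5 (arXiv v5 p. 9)] [cite: MadrasSlade1993, Section 4.2, (4.2.4) (p. 91)] -/
theorem tendsto_seventh_order_lower :
    Tendsto (fun y : ℝ => y ^ 5 * ((y / wallRate y ^ 2) ^ 2 - 1) + y ^ 4 * ((y / wallRate y ^ 2) ^ 3 - 1) +
        y ^ 3 * (3 * (y / wallRate y ^ 2) ^ 4 + (y / wallRate y ^ 2) ^ 5 - 2) +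
        y ^ 2 * (6 * (y / wallRate y ^ 2) ^ 5 + 3 * (y / wallRate y ^ 2) ^ 6 - 4) +
        y * (15 * (y / wallRate y ^ 2) ^ 6 + 11 * (y / wallRate y ^ 2) ^ 7 + (y / wallRate y ^ 2) ^ 8 - 6) +
        (38 * (y / wallRate y ^ 2) ^ 7 + 34 * (y / wallRate y ^ 2) ^ 8 + 7 * (y / wallRate y ^ 2) ^ 9)) atTop (𝓝 12) := by
  refine tendsto_R_sv.congr' ?_
  filter_upwards [eventually_gt_atTop (0 : ℝ)] with y hy
  have h := G_eq_R_sv hy.ne' (y / wallRate y ^ 2)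
  unfold G_sv at h
  exact h.symm

/-- ★★ **THE SEVENTH-ORDER FLOOR:** for every `ε > 0`, eventually `12 − ε ≤ y⁶ (β(y)² − y − 1/y − 1/y² − 2/y³ − 4/y⁴ − 6/y⁵)`
(`liminf ≥ 12`; `12 = N₈₁ + N₉₂ + N₁₀,₃ − 67 = 38 + 34 + 7 − 67` in the census bookkeeping).
[cite: BeatonBousquetMelouDeGierDuminilCopinGuttmann2014, Section 3.1, Proposition 5 (arXiv v5 p. 9); p. 10 (first-order remark)] [cite: Kesten1963SAW, Section 4] [cite: MadrasSlade1993, Section 4.2, Theorem 4.2.2 (pp. 91–92)] -/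
theorem eventually_twelve_sub_le_pow_six_mul_wallRate_sq_sub {ε : ℝ} (hε : 0 < ε) :
    ∀ᶠ y : ℝ in atTop, 12 - ε ≤ y ^ 6 * (wallRate y ^ 2 - y - 1 / y - 1 / y ^ 2 - 2 / y ^ 3 - 4 / y ^ 4 - 6 / y ^ 5) := by
  have hlo := tendsto_seventh_order_lower.eventually (eventually_gt_nhds (show (12 : ℝ) - ε < 12 by linarith))
  filter_upwards [hlo, eventually_gt_atTop (hexConnectiveConstant ^ 4)] with y h1 hy
  exact h1.le.trans (seventh_order_lower hy)

/-- ★★ The floor as an inequality for `β²`: for every `ε > 0`, eventually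
`y + 1/y + 1/y² + 2/y³ + 4/y⁴ + 6/y⁵ + (12 − ε)/y⁶ ≤ β(y)²`. [cite: BeatonBousquetMelouDeGierDuminilCopinGuttmann2014, Section 3.1, Proposition 5 (arXiv v5 p. 9)] -/
theorem eventually_seventh_order_floor {ε : ℝ} (hε : 0 < ε) :
    ∀ᶠ y : ℝ in atTop, y + 1 / y + 1 / y ^ 2 + 2 / y ^ 3 + 4 / y ^ 4 + 6 / y ^ 5 + (12 - ε) / y ^ 6 ≤ wallRate y ^ 2 := by
  filter_upwards [eventually_twelve_sub_le_pow_six_mul_wallRate_sq_sub hε, eventually_gt_atTop (0 : ℝ)] with y h1 hy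
  have hy6 : 0 < y ^ 6 := pow_pos hy 6
  have e2 : wallRate y ^ 2 = (y + 1 / y + 1 / y ^ 2 + 2 / y ^ 3 + 4 / y ^ 4 + 6 / y ^ 5) +
      (y ^ 6 * (wallRate y ^ 2 - y - 1 / y - 1 / y ^ 2 - 2 / y ^ 3 - 4 / y ^ 4 - 6 / y ^ 5)) / y ^ 6 := by
    field_simp
    ring
  have e : y + 1 / y + 1 / y ^ 2 + 2 / y ^ 3 + 4 / y ^ 4 + 6 / y ^ 5 + (12 - ε) / y ^ 6 =
      (y + 1 / y + 1 / y ^ 2 + 2 / y ^ 3 + 4 / y ^ 4 + 6 / y ^ 5) + (12 - ε) / y ^ 6 := by ring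
  rw [e, e2]
  gcongr

/-- ★ Consequently, IF the seventh-order limit exists, it is at least twelve. [cite: MadrasSlade1993, Section 4.2, Theorem 4.2.2 (pp. 91–92)] -/
theorem twelve_le_of_tendsto_pow_six_mul_wallRate_sq_sub {L : ℝ}
    (h : Tendsto (fun y : ℝ => y ^ 6 * (wallRate y ^ 2 - y - 1 / y - 1 / y ^ 2 - 2 / y ^ 3 - 4 / y ^ 4 - 6 / y ^ 5)) atTop (𝓝 L)) :
    12 ≤ L := by
  refine le_of_tendsto_of_tendsto tendsto_seventh_order_lower h ?_
  filter_upwards [eventually_gt_atTop (hexConnectiveConstant ^ 4)] with y hy using seventh_order_lower hy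

end Literature.Probability.RandomPlanarGeometry.SAW.HexBW.Wall
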